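import Mathlib
import HarnessLib
import Summits.HubbardSuperconductivity.HubbardSuperconductivity.Theorems.KLProgrammeKLRegimeVolumeLimitCutoffFreeDefs

/-!
# Riemann–Lebesgue in the MATSUBARA LABEL: Matsubara transforms over `[0,β]` vanish as the frequency index `n → ∞`;
# the cutoff-free six-point scalar `Six∞_L(n,p) → 0` at every fixed volume
# (seat hubbard-kl-k3c5-p1 g5, technique «stub_asm_matsubara suppliers»; VL child `KLRegimeVolumeLimitV14`, stmt-HubbardSuperconductivity-19921)

The VL child's last registered debt (plan g13 (R6), «cauchy» v2) is `stub_vl_rates`: two-volume rates of the density `occ∞(L)` and of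
k3c5-p3's cutoff-free six-point Matsubara coefficient
`Six∞_L(n,p) = klSixInf L β U μ n p = D∞⁻¹·∫₀^β e^{−iω_n u} (Σ_z conj χ_p(z) S∞(z,u)) du`, `ω_n = π(2n+1)/β` (`…VolumeLimitCutoffFreeDefs`).
This file supplies the LABEL direction of that object at a FIXED volume: since `u ↦ S∞(z,u)` is integrable on `[0,β]`
(`klSixWordInf_integrable_and_l1`), the Riemann–Lebesgue lemma (Mathlib's `Real.tendsto_integral_exp_smul_cocompact`, applied to the
integrand extended by `0` off `(0,β]`) gives

* `tendsto_intervalIntegral_cexp_neg_mul_atTop` / `tendsto_intervalIntegral_cexp_pos_mul_atTop` — MODEL-FREE: for ANY `g : ℝ → ℂ` and `a ≤ b`,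
  `∫_a^b e^{∓iku} g(u) du → 0` as `k → +∞` (no integrability hypothesis: a non-integrable `g` has integral `0` by convention);
* `tendsto_fermiMatsubara_atTop` — the tree's fermionic frequencies `ω_n = π(2n+1)/β → +∞` (`β > 0`);
* `tendsto_matsubaraTransform_neg_atTop` / `tendsto_matsubaraTransform_pos_atTop` — hence `∫_a^b e^{∓iω_n u} g(u) du → 0` as `n → ∞`;
* **`tendsto_klSixInf_atTop`** — `klSixInf L β U μ n p → 0` as `n → +∞` (through `ℕ`), for every `L`, `β > 0`, `U`, `μ`, `p`.

Use (next files of this seat): the `n → ∞` limit separates the density from the six-point scalar in the exact Schwinger–Dyson identity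
`U·occ∞ + U²·Six∞_L(n,p) = Σ_H(L;n,p)` (label by label), identifying `occ∞` with the anticommutator term and `Six∞` with the dressed-mode
two-time transform; and it converts a finite-cutoff two-volume rate of the carrier (v1 text of the «cauchy» skeleton) into the v2 rates
(b1) ∧ (b2).  Everything is proved; no definition.
-/

noncomputable section

namespace Summit.HubbardSuperconductivity.HubbardSuperconductivity.Theorems.TwoPointAssembly

set_option linter.dupNamespace false -- summit = problem name (single-conjunct summit), D-0017

open Finset Filter Topology MeasureTheory intervalIntegral Complex Literature.MathematicalPhysics.QuantumLattice Literature.Probability.LatticeModels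
open scoped ComplexConjugate Real

/-! ## §1 Riemann–Lebesgue for interval Matsubara transforms (model-free) -/

/-- The Fourier character at `−(v·(k/2π))` is `e^{−ikv}`. -/
theorem fourierChar_neg_mul_div_two_pi (v k : ℝ) :
    (((Real.fourierChar (-(v * (k / (2 * π))))) : Circle) : ℂ) = cexp (-(((k * v : ℝ) : ℂ) * I)) := by
  rw [Real.fourierChar_apply]
  congr 1
  have hπ : (π : ℂ) ≠ 0 := by exact_mod_cast Real.pi_ne_zero
  push_cast
  field_simp

/-- The Fourier character at `−(v·(−k/2π))` is `e^{+ikv}`. -/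
theorem fourierChar_neg_mul_neg_div_two_pi (v k : ℝ) :
    (((Real.fourierChar (-(v * (-k / (2 * π))))) : Circle) : ℂ) = cexp (I * k * v) := by
  rw [Real.fourierChar_apply]
  congr 1
  have hπ : (π : ℂ) ≠ 0 := by exact_mod_cast Real.pi_ne_zero
  push_cast
  field_simp

/-- **Riemann–Lebesgue, interval form, frequency sign `−`**: for any `g : ℝ → ℂ` and `a ≤ b`, `∫_a^b e^{−iku} g(u) du → 0` as `k → +∞`. -/
theorem tendsto_intervalIntegral_cexp_neg_mul_atTop (g : ℝ → ℂ) {a b : ℝ} (hab : a ≤ b) :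
    Tendsto (fun k : ℝ => ∫ u in a..b, cexp (-(((k * u : ℝ) : ℂ) * I)) * g u) atTop (𝓝 0) := by
  set f : ℝ → ℂ := (Set.Ioc a b).indicator g with hf
  have hRL := Real.tendsto_integral_exp_smul_cocompact f
  have hT : Tendsto (fun k : ℝ => k / (2 * π)) atTop (cocompact ℝ) :=
    (tendsto_id.atTop_div_const (by positivity)).mono_right atTop_le_cocompact
  refine (hRL.comp hT).congr fun k => ?_
  simp only [Function.comp]
  rw [intervalIntegral.integral_of_le hab, ← MeasureTheory.integral_indicator measurableSet_Ioc]
  congr 1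
  ext v
  by_cases hv : v ∈ Set.Ioc a b
  · rw [hf, Set.indicator_of_mem hv, Set.indicator_of_mem hv, Circle.smul_def, smul_eq_mul,
      fourierChar_neg_mul_div_two_pi]
  · rw [hf, Set.indicator_of_notMem hv, Set.indicator_of_notMem hv, smul_zero]

/-- **Riemann–Lebesgue, interval form, frequency sign `+`**: for any `g : ℝ → ℂ` and `a ≤ b`, `∫_a^b e^{iku} g(u) du → 0` as `k → +∞`. -/
theorem tendsto_intervalIntegral_cexp_pos_mul_atTop (g : ℝ → ℂ) {a b : ℝ} (hab : a ≤ b) :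
    Tendsto (fun k : ℝ => ∫ u in a..b, cexp (I * k * u) * g u) atTop (𝓝 0) := by
  set f : ℝ → ℂ := (Set.Ioc a b).indicator g with hf
  have hRL := Real.tendsto_integral_exp_smul_cocompact f
  have hT : Tendsto (fun k : ℝ => -k / (2 * π)) atTop (cocompact ℝ) :=
    (tendsto_neg_atTop_atBot.atBot_div_const (by positivity)).mono_right atBot_le_cocompact
  refine (hRL.comp hT).congr fun k => ?_
  simp only [Function.comp]
  rw [intervalIntegral.integral_of_le hab, ← MeasureTheory.integral_indicator measurableSet_Ioc]
  congr 1
  ext v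
  by_cases hv : v ∈ Set.Ioc a b
  · rw [hf, Set.indicator_of_mem hv, Set.indicator_of_mem hv, Circle.smul_def, smul_eq_mul,
      fourierChar_neg_mul_neg_div_two_pi]
  · rw [hf, Set.indicator_of_notMem hv, Set.indicator_of_notMem hv, smul_zero]

/-! ## §2 Along the fermionic Matsubara frequencies `ω_n = π(2n+1)/β` -/

/-- `ω_n = π(2n+1)/β → +∞` as `n → ∞` (`β > 0`), `n` through `ℕ` cast to `ℤ` (the tree's label type). -/
theorem tendsto_fermiMatsubara_atTop {β : ℝ} (hβ : 0 < β) :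
    Tendsto (fun n : ℕ => Real.pi * (2 * ((n : ℤ) : ℝ) + 1) / β) atTop atTop := by
  have h1 : Tendsto (fun n : ℕ => 2 * (n : ℝ) + 1) atTop atTop :=
    tendsto_atTop_add_const_right _ 1 (tendsto_natCast_atTop_atTop.const_mul_atTop two_pos)
  have h2 : Tendsto (fun n : ℕ => Real.pi * (2 * (n : ℝ) + 1) / β) atTop atTop :=
    (h1.const_mul_atTop Real.pi_pos).atTop_div_const hβ
  refine h2.congr fun n => ?_
  simp

/-- **Matsubara Riemann–Lebesgue, sign `−`**: `∫_a^b e^{−iω_n u} g(u) du → 0` as `n → ∞` (any `g`, `a ≤ b`, `β > 0`). -/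
theorem tendsto_matsubaraTransform_neg_atTop (g : ℝ → ℂ) {a b β : ℝ} (hab : a ≤ b) (hβ : 0 < β) :
    Tendsto (fun n : ℕ => ∫ u in a..b, cexp (-((((Real.pi * (2 * ((n : ℤ) : ℝ) + 1) / β) * u : ℝ) : ℂ) * I)) * g u) atTop (𝓝 0) :=
  (tendsto_intervalIntegral_cexp_neg_mul_atTop g hab).comp (tendsto_fermiMatsubara_atTop hβ)

/-- **Matsubara Riemann–Lebesgue, sign `+`**: `∫_a^b e^{iω_n u} g(u) du → 0` as `n → ∞` (any `g`, `a ≤ b`, `β > 0`). -/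
theorem tendsto_matsubaraTransform_pos_atTop (g : ℝ → ℂ) {a b β : ℝ} (hab : a ≤ b) (hβ : 0 < β) :
    Tendsto (fun n : ℕ => ∫ u in a..b, cexp (I * ((Real.pi * (2 * ((n : ℤ) : ℝ) + 1) / β : ℝ) : ℂ) * u) * g u) atTop (𝓝 0) := by
  have h := (tendsto_intervalIntegral_cexp_pos_mul_atTop g hab).comp (tendsto_fermiMatsubara_atTop hβ)
  refine h.congr fun n => ?_
  simp only [Function.comp]

/-! ## §3 The cutoff-free six-point scalar vanishes at large Matsubara label, at every fixed volume -/

variable {L : ℕ} [NeZero L]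

/-- The `klSixInf` integrand is a Matsubara phase times the site sum `G_p(u) = Σ_z conj χ_p(z) S∞(z,u)`. -/
theorem klSixInf_eq_integral_phase_mul (β U μ : ℝ) (n : ℤ) (p : TorusSite 2 L) :
    klSixInf L β U μ n p =
      (∫ u in (0 : ℝ)..β, cexp (-(((Real.pi * (2 * (n : ℝ) + 1) / β * u : ℝ) : ℂ) * I)) *
          ∑ z : TorusSite 2 L, conj (torusChar p z) * klSixWordInf L β U μ z u) / klDInf L β U μ := by
  rw [klSixInf]
  congr 1
  refine intervalIntegral.integral_congr fun u _ => ?_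
  simp only [Finset.mul_sum, mul_assoc]

/-- **RIEMANN–LEBESGUE FOR `Six∞_L(n,p)`**: at every fixed volume `L`, for `β > 0` and every `U, μ, p`,
`klSixInf L β U μ n p → 0` as `n → +∞`. -/
theorem tendsto_klSixInf_atTop {β : ℝ} (hβ : 0 < β) (U μ : ℝ) (p : TorusSite 2 L) :
    Tendsto (fun n : ℕ => klSixInf L β U μ (n : ℤ) p) atTop (𝓝 0) := by
  have h := (tendsto_matsubaraTransform_neg_atTop
    (fun u => ∑ z : TorusSite 2 L, conj (torusChar p z) * klSixWordInf L β U μ z u) hβ.le hβ).div_const (klDInf L β U μ)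
  rw [zero_div] at h
  refine h.congr fun n => ?_
  rw [klSixInf_eq_integral_phase_mul]

end Summit.HubbardSuperconductivity.HubbardSuperconductivity.Theorems.TwoPointAssembly

end
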